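import Literature.NumberTheory.EllipticCurves.TwoIsogenySelmerGroupProofs
import Literature.NumberTheory.EllipticCurves.TwoIsogenyDescent
import Literature.NumberTheory.EllipticCurves.VariableChangePointsMap
import Literature.NumberTheory.EllipticCurves.MordellWeilModNCard
import Literature.NumberTheory.EllipticCurves.KubertTwoTenProofs
import Literature.NumberTheory.EllipticCurves.KramerTwoDescentSquares
import HarnessLib

/-!
# The rank bound of the descent via `2`-isogeny: `rank E(ℚ) + 2 ≤ dim₂ S^{(φ̂)} + dim₂ S^{(φ)}`
# (Silverman–Tate, *Rational Points on Elliptic Curves*, §3.4–§3.6)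

Sibling proof file of `Literature.NumberTheory.EllipticCurves.TwoIsogenySelmerGroup`: it
discharges the named fact `twoIsogeny_mordellWeilRank_add_two_le` stated there — for `a, b ∈ ℤ`
with `b (a² - 4b) ≠ 0` and `E = E_{a,b} : y² = x³ + a x² + b x` over `ℚ`,
`rank E(ℚ) + 2 ≤ twoIsogenySelmerRank a b + twoIsogenySelmerRank' a b`
(`theorem twoIsogeny_mordellWeilRank_add_two_le_holds`). Everything here is proved; there are no
new definitions and no named facts.

The proof is Silverman–Tate's (Ch. 3, §3.4–§3.6 of the 2015 edition), followed step by step, the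
ingredients already in the tree being: the explicit `2`-isogeny `φ : E → E' = E.twoIsogenyCodomain`
as a homomorphism of point groups (`twoIsogenyHom`, `IsogenyTwoTorsionProofs.lean`; Prop. 3.7(a)),
`ψ ∘ φ = [2]` on coordinates and the halving criterion (`twoIsogenyFun_twoIsogenyFun`,
`exists_twoIsogenyFun_eq`, `TwoIsogenyDescent.lean`; Prop. 3.7(c), §3.4 (i)–(iii)), the
homomorphism `α : E(F) → F*/F*²` (`xSqClass`, `xSqClass_add`, `TwoIsogenyDescentAlpha.lean`;
Prop. 3.8(a)) with the solubility criterion `exists_sq_eq_quartic_iff` (§3.6), the Mordell–Weil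
theorem (`module_finite_point_holds`) with the count `(Γ : 2Γ) = 2^r · #Γ[2]`
(`natCard_quotient_nsmulRange_point_eq`, `MordellWeilModNCard.lean`; §3.6), the parity
`v_p(x) ≡ 0 (mod 2)` for `p ∤ b` (`even_padicValRat_of_twoTorsionNF`; Prop. 3.8(c)), and
`#S = 2^{dim}` (`two_pow_twoIsogenySelmerRank_eq_card`, `TwoIsogenySelmerGroupProofs.lean`).
What is added here:

* `WeierstrassCurve.mem_range_twoIsogenyFun_of_xSqClass_eq_one` — **`ker ᾱ ⊆ φ(E(F))`**
  (Prop. 3.8(b) for `C̄`, from §3.4 (i)–(iii)): `ᾱ(Q) = 1` forces `Q = 𝒪̄`, or `Q = T̄` with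
  `a² - 4b = w²` (then `T̄ = φ((-a + w)/2, 0)`), or `x(Q)` a non-zero square (halving).
* `WeierstrassCurve.exists_addEquiv_scale` — the isomorphism **`E(F) ≃+ E''(F)`,
  `(x, y) ↦ (4x, 8y)`** onto `E'' = (E')' = ⟨0, 4a, 0, 16b, 0⟩` (Prop. 3.7(b): "`C̄̄` is
  isomorphic to `C` via `(x, y) ↦ (x/4, y/8)`"), as the tree's `VariableChange.pointEquiv` for
  `(u, r, s, t) = (1/2, 0, 0, 0)`; `xSqClass_scale`: it preserves `α`.
* `WeierstrassCurve.exists_dual_twoIsogenyHom` — **the dual isogeny `ψ : E'(F) →+ E(F)`**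
  (`= (E'' ≅ E) ∘ φ'`) with `ψ ∘ φ = [2]`, `ψ(T̄) = 𝒪`, `ker ψ ⊆ {𝒪̄, T̄}` and
  **`ker α ⊆ ψ(E'(F))`** (Prop. 3.7(b)–(c), Prop. 3.8(b)).
* `WeierstrassCurve.four_le_natCard_torsionBy_of_mem_range` — if `T̄ ∈ φ(E(F))` then
  `#E(F)[2] ≥ 4` (§3.6: "`T̄ ∈ φ(Γ)` iff `a² - 4b` is a square", "`#Γ[2] = 4` if `a² - 4b` is a
  square").
* `WeierstrassCurve.index_le_natCard_range_xSqClass` — `[E(F) : H] ≤ #α(E(F))` for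
  `H ⊇ ker α` ("`α(Γ) ≅ Γ/ker(α)`", §3.6).
* `index_nsmulRange_mul_relIndex_eq` — the **index identity**
  `(A : 2A) · (ker ψ : ker ψ ∩ φA) = (A : ψB) · (B : φA)` for `ψ ∘ φ = 2` (Lemma 3.9 and the
  "abstract remark" `(ψ(A) : ψ(B)) = (A : B)/(ker ψ : ker ψ ∩ B)` of §3.6).
* `two_pow_mordellWeilRank_add_two_le` — over a number field: **`2^{r+2} ≤ #α(Γ) · #ᾱ(Γ̄)`**
  (§3.6: `2^r = (Γ : ψΓ̄)(Γ̄ : φΓ)/4 = #α(Γ)·#ᾱ(Γ̄)/4`; the inequality is what the rank bound uses: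
  `#Γ[2] · (ker ψ : ker ψ ∩ φΓ) ≥ 4` in both cases `T̄ ∈ φΓ`, `T̄ ∉ φΓ`).
* `exists_squarefree_dvd_sqClass_eq`, `range_xSqClass_subset_image_twoIsogenySelmerGroup`,
  `natCard_range_xSqClass_le` — over `ℚ`: **`α(Γ) ⊆ S(a, b)`**, every class of `α(E_{a,b}(ℚ))`
  being `[d]` for a squarefree `d ∣ b` (Prop. 3.8(c)) whose homogeneous space
  `w² = d u⁴ + a u²z² + (b/d) z⁴` has a `ℚ`-point (§3.6), hence points over `ℝ` and all `ℚ_p`;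
  so `#α(Γ) ≤ #S(a, b)` and likewise `#ᾱ(Γ̄) ≤ #S(-2a, a² - 4b)`.
* `twoIsogeny_mordellWeilRank_add_two_le_holds` — the assembly
  `2^{r+2} ≤ #α(Γ)#ᾱ(Γ̄) ≤ #S · #S' = 2^{dim S + dim S'}`.

## References

* J. H. Silverman, J. T. Tate, *Rational Points on Elliptic Curves*, 2nd ed., UTM, Springer
  (2015), Ch. 3: Prop. 3.7 (the isogenies `φ`, `ψ`, `ψ ∘ φ = [2]`; PDF p. 76 of the held copy),
  §3.4 (i)–(iii) (description of `ψ(Γ̄)`; p. 81), Prop. 3.8 (the homomorphism `α`, `ker α = ψ(Γ̄)`,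
  `α(Γ) ⊆ {±∏ pᵢ^{εᵢ}}`; p. 82), Lemma 3.9 (`(A : 2A) ≤ (A : ψB)(B : φA)`; p. 84), §3.6
  (`(Γ : 2Γ) = 2^r #Γ[2]`, `#Γ[2] ∈ {2, 4}`, `(ψ(A) : ψ(B)) = (A : B)/(ker ψ : ker ψ ∩ B)`,
  `2^r = #α(Γ)·#ᾱ(Γ̄)/4`, `x = b₁M²/e²` with `b₁ ∣ b`; pp. 85–88). [SilvermanTate2015]
* J. H. Silverman, *The Arithmetic of Elliptic Curves*, 2nd ed., GTM 106 (2009), Prop. X.4.9 and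
  Remark X.4.7 (the same descent in cohomological language). [SilvermanAEC2009]

## Design

Theorems only; `noncomputable section`, `open scoped Classical` and no `[DecidableEq]`
variables, as in the sibling files, so that the group law on points is elaborated against the
classical instances throughout: all group-theoretic statements are proved for a general field
(resp. number field) `F`, and only statements free of the group law (`Set.range W.xSqClass`,
`mordellWeilRank`, the Selmer sets) are specialised to the literal curve `⟨0, a, 0, b, 0⟩` over
`ℚ`. The dual isogeny and the scaling isomorphism are produced as existential statements
(`∃ ψ, …`, `∃ σ, …`) rather than definitions.
-/

noncomputable section

open scoped Classical

namespace WeierstrassCurve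

open WeierstrassCurve.Affine (SqUnits sqClass sqClass_mul sqClass_sq sqClass_eq_one_iff)

variable {F : Type*} [Field F] (W : WeierstrassCurve F) [W.IsTwoTorsionNF] [W.IsElliptic]

/-! ### `ker ᾱ ⊆ φ(E(F))` -/

/-- **`ker ᾱ ⊆ φ(Γ)`** (Silverman–Tate, Prop. 3.8(b) for the curve `C̄` and §3.4 statements
(i)–(iii): `φ(Γ)` consists of `𝒪̄`, of `T̄` if `b̄ = a² - 4b` is a square, and of the `(x̄, ȳ)`
with `x̄` a non-zero square). For `Q ∈ E'(F)` with `ᾱ(Q) = 1` — i.e. `Q = 𝒪̄`, or `Q = T̄` with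
`a² - 4b = w²`, or `Q = (X, Y)` with `X` a non-zero square — `Q` lies in the image of the explicit
`2`-isogeny `φ : E(F) → E'(F)`: `φ(𝒪) = 𝒪̄`; `φ((-a + w)/2, 0) = T̄` (a `2`-torsion point of `E`,
`x₁x₂ = b` for the two roots of `x² + ax + b`); and the halving criterion
`exists_twoIsogenyFun_eq`. [cite: SilvermanTate2015, Prop. 3.7 and §3.4 (i)–(iii), Prop. 3.8(b)] -/
theorem mem_range_twoIsogenyFun_of_xSqClass_eq_one (Q : W.twoIsogenyCodomain.toAffine.Point)
    (hQ : W.twoIsogenyCodomain.xSqClass Q = 1) : Q ∈ Set.range W.twoIsogenyFun := by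
  have h2 := two_ne_zero' W
  have hb := a₄_ne_zero W
  have hb' : W.a₂ ^ 2 - 4 * W.a₄ ≠ 0 := a₂_sq_sub_ne_zero W
  rcases Q with _ | ⟨X, Y, hXY⟩
  · exact ⟨0, rfl⟩
  by_cases hX : X = 0
  · -- `Q = T̄`: `ᾱ(T̄) = [a² - 4b] = 1`
    have hY := y_eq_zero_of_x_eq_zero _ hXY hX
    subst hX hY
    rw [xSqClass_some_of_eq_zero _ rfl, twoIsogenyCodomain_a₄, sqClass_eq_one_iff hb'] at hQ
    obtain ⟨w, hw⟩ := hQ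
    -- the `2`-torsion point `(x₁, 0)`, `x₁ = (-a + w)/2`, of `E`
    set x₁ : F := (-W.a₂ + w) / 2 with hx₁
    have hx₁' : 2 * x₁ = -W.a₂ + w := by rw [hx₁]; field_simp
    have hquad : x₁ ^ 2 + W.a₂ * x₁ + W.a₄ = 0 := by
      have h4 : (4 : F) ≠ 0 := by
        rw [show (4 : F) = 2 * 2 by norm_num]; exact mul_ne_zero h2 h2
      apply mul_left_cancel₀ h4
      linear_combination (2 * x₁ + W.a₂ + w) * hx₁' - hw
    have hx₁0 : x₁ ≠ 0 := by
      rintro h0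
      rw [h0] at hquad
      exact hb (by simpa using hquad)
    have heq : W.toAffine.Equation x₁ 0 := by
      rw [equation_iff_of_isTwoTorsionNF]
      linear_combination -x₁ * hquad
    have hns : W.toAffine.Nonsingular x₁ 0 := Affine.equation_iff_nonsingular.mp heq
    refine ⟨.some x₁ 0 hns, ?_⟩
    rw [twoIsogenyFun_some W hns hx₁0]
    obtain ⟨h', e⟩ := some_eq_some_of_eq (V := W.twoIsogenyCodomain)
      (nonsingular_twoIsogeny W hns.left hx₁0) (x' := 0) (y' := 0)
      (by rw [twoIsogenyX, hquad, zero_div]) (by rw [twoIsogenyY, zero_mul, zero_div])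
    exact e
  · -- `Q = (X, Y)`, `X = w² ≠ 0`: halving
    rw [xSqClass_some_of_ne_zero _ hX, sqClass_eq_one_iff hX] at hQ
    obtain ⟨w, hw⟩ := hQ
    have hw0 : w ≠ 0 := by
      rintro rfl
      exact hX (by rw [hw]; ring)
    exact W.exists_twoIsogenyFun_eq hXY hw hw0

/-! ### The isomorphism `E ≅ E''`, `(x, y) ↦ (4x, 8y)`, and the dual isogeny `ψ` -/

/-- **`E ≅ E''` by `(x, y) ↦ (4x, 8y)`** (Silverman–Tate, Prop. 3.7(b): "the curve `C̄̄` is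
isomorphic to `C` via the map `(x, y) ↦ (x/4, y/8)`"): the admissible change of variables
`(u, r, s, t) = (1/2, 0, 0, 0)` carries `E : y² = x³ + ax² + bx` to
`E'' = ⟨0, 4a, 0, 16b, 0⟩ = (E')'`, and induces the group isomorphism `E(F) ≃+ E''(F)`,
`(x, y) ↦ (4x, 8y)` (the tree's `VariableChange.pointEquiv`). [cite: SilvermanTate2015, Prop. 3.7(b)] -/
theorem exists_addEquiv_scale :
    ∃ σ : W.toAffine.Point ≃+ W.twoIsogenyCodomain.twoIsogenyCodomain.toAffine.Point,
      ∀ {x y : F} (h : W.toAffine.Nonsingular x y),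
        σ (.some x y h) = .some (4 * x) (8 * y) (W.nonsingular_scale h) := by
  have h2 := two_ne_zero' W
  set C : VariableChange F := ⟨(Units.mk0 (2 : F) h2)⁻¹, 0, 0, 0⟩ with hC
  have hu : ((C.u⁻¹ : Fˣ) : F) = 2 := by simp [hC]
  have hCW : C • W = W.twoIsogenyCodomain.twoIsogenyCodomain := by
    ext
    · simp [variableChange_a₁, hC]
    · rw [variableChange_a₂, hu]; simp [hC, twoIsogenyCodomain]; ring
    · simp [variableChange_a₃, hC]
    · rw [variableChange_a₄, hu]; simp [hC, twoIsogenyCodomain]; ring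
    · rw [variableChange_a₆, hu]; simp [hC, twoIsogenyCodomain]
  have hr : C.r = 0 := by simp [hC]
  have hs : C.s = 0 := by simp [hC]
  have ht : C.t = 0 := by simp [hC]
  refine ⟨(VariableChange.pointEquiv W C).trans (Affine.Point.congrEquiv hCW), fun {x y} h => ?_⟩
  rw [AddEquiv.trans_apply, VariableChange.pointEquiv_some, Affine.Point.congrEquiv_some]
  obtain ⟨h', e⟩ := some_eq_some_of_eq (V := W.twoIsogenyCodomain.twoIsogenyCodomain)
    (hCW ▸ (VariableChange.nonsingular_iff W C x y).mpr h) (x' := 4 * x) (y' := 8 * y)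
    (by rw [VariableChange.toX_def, hu, hr]; ring)
    (by rw [VariableChange.toY_def, hu, hr, hs, ht]; ring)
  exact e

/-- **`α'' ∘ σ = α`**: the isomorphism `(x, y) ↦ (4x, 8y)` does not change square classes
(`[4x] = [x]`, `[16b] = [b]`). [folklore] -/
theorem xSqClass_scale {σ : W.toAffine.Point ≃+ W.twoIsogenyCodomain.twoIsogenyCodomain.toAffine.Point}
    (hσ : ∀ {x y : F} (h : W.toAffine.Nonsingular x y),
      σ (.some x y h) = .some (4 * x) (8 * y) (W.nonsingular_scale h))
    (P : W.toAffine.Point) :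
    W.twoIsogenyCodomain.twoIsogenyCodomain.xSqClass (σ P) = W.xSqClass P := by
  have h2 := two_ne_zero' W
  have h4 : (4 : F) ≠ 0 := by
    rw [show (4 : F) = 2 * 2 by norm_num]; exact mul_ne_zero h2 h2
  have hb := a₄_ne_zero W
  rcases P with _ | ⟨x, y, h⟩
  · rw [← Affine.Point.zero_def, map_zero, xSqClass_zero, xSqClass_zero]
  rw [hσ h]
  by_cases hx : x = 0
  · rw [xSqClass_some_of_eq_zero _ (by rw [hx, mul_zero]), xSqClass_some_of_eq_zero _ hx,
      twoIsogenyCodomain_a₄, twoIsogenyCodomain_a₂, twoIsogenyCodomain_a₄,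
      show (-2 * W.a₂) ^ 2 - 4 * (W.a₂ ^ 2 - 4 * W.a₄) = 4 ^ 2 * W.a₄ by ring,
      sqClass_mul (pow_ne_zero 2 h4) hb, sqClass_sq, Affine.SqUnits.one_mul]
  · rw [xSqClass_some_of_ne_zero _ (mul_ne_zero h4 hx), xSqClass_some_of_ne_zero _ hx,
      show (4 : F) * x = 2 ^ 2 * x by norm_num, sqClass_mul (pow_ne_zero 2 h2) hx, sqClass_sq,
      Affine.SqUnits.one_mul]

/-- **The dual isogeny `ψ : E'(F) → E(F)` and its properties** (Silverman–Tate, Prop. 3.7(b),(c)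
and Prop. 3.8(b)): `ψ = (E'' ≅ E) ∘ φ'` with `φ' : E' → E''` the explicit `2`-isogeny of `E'`,
satisfies `ψ ∘ φ = [2]` (`twoIsogenyFun_twoIsogenyFun`), `ψ(T̄) = 𝒪`, `ker ψ ⊆ {𝒪̄, T̄}`, and
`ker α ⊆ ψ(E'(F))` (from `ker α'' ⊆ φ'(E'(F))` on `E'` and `α'' ∘ σ = α`).
[cite: SilvermanTate2015, Prop. 3.7(b)–(c), Prop. 3.8(b)] -/
theorem exists_dual_twoIsogenyHom :
    ∃ ψ : W.twoIsogenyCodomain.toAffine.Point →+ W.toAffine.Point,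
      (∀ P : W.toAffine.Point, ψ (W.twoIsogenyFun P) = 2 • P) ∧
      W.twoIsogenyCodomain.twoTorsionPoint ∈ ψ.ker ∧
      (∀ Q ∈ ψ.ker, Q = 0 ∨ Q = W.twoIsogenyCodomain.twoTorsionPoint) ∧
      (∀ P : W.toAffine.Point, W.xSqClass P = 1 → P ∈ ψ.range) := by
  obtain ⟨σ, hσ⟩ := W.exists_addEquiv_scale
  refine ⟨σ.symm.toAddMonoidHom.comp W.twoIsogenyCodomain.twoIsogenyHom, ?_, ?_, ?_, ?_⟩
  · -- `ψ ∘ φ = [2]`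
    intro P
    rw [AddMonoidHom.comp_apply, twoIsogenyHom_apply, AddEquiv.coe_toAddMonoidHom,
      AddEquiv.symm_apply_eq]
    rcases W.twoIsogenyFun_twoIsogenyFun P with ⟨h2P, h0⟩ | ⟨x', y', h', h2P, hφ⟩
    · rw [h0, h2P, map_zero]
    · rw [hφ, h2P, hσ h']
  · -- `ψ(T̄) = 𝒪`
    rw [AddMonoidHom.mem_ker, AddMonoidHom.comp_apply, twoIsogenyHom_apply,
      twoIsogenyFun_twoTorsionPoint, map_zero]
  · -- `ker ψ ⊆ {𝒪̄, T̄}`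
    intro Q hQ
    rw [AddMonoidHom.mem_ker, AddMonoidHom.comp_apply, twoIsogenyHom_apply,
      AddEquiv.coe_toAddMonoidHom, AddEquiv.symm_apply_eq, map_zero] at hQ
    rcases Q with _ | ⟨X, Y, hXY⟩
    · exact Or.inl rfl
    by_cases hX : X = 0
    · have hY := y_eq_zero_of_x_eq_zero _ hXY hX
      subst hX hY
      exact Or.inr rfl
    · rw [twoIsogenyFun_some _ hXY hX] at hQ
      exact absurd hQ (Affine.Point.some_ne_zero _)
  · -- `ker α ⊆ ψ(E'(F))`
    intro P hP
    have hP' : W.twoIsogenyCodomain.twoIsogenyCodomain.xSqClass (σ P) = 1 := by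
      rw [W.xSqClass_scale hσ, hP]
    obtain ⟨Q, hQ⟩ :=
      W.twoIsogenyCodomain.mem_range_twoIsogenyFun_of_xSqClass_eq_one (σ P) hP'
    refine ⟨Q, ?_⟩
    rw [AddMonoidHom.comp_apply, twoIsogenyHom_apply, AddEquiv.coe_toAddMonoidHom,
      AddEquiv.symm_apply_eq, hQ]

/-! ### Four rational `2`-torsion points when `T̄ ∈ φ(E(F))` -/

/-- If `T̄ = φ(P)` then `P = (x₁, 0)` is a `2`-torsion point of `E` other than `𝒪, T`, so
`𝒪, T, P, P + T` are four distinct points of `E(F)[2]` (Silverman–Tate §3.6: "`#Γ[2] = 4` if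
`a² - 4b` is a square", and "`T̄ ∈ φ(Γ)` if and only if `b̄ = a² - 4b` is a square").
[cite: SilvermanTate2015, §3.6] -/
theorem four_le_natCard_torsionBy_of_mem_range
    [Finite (AddSubgroup.torsionBy W.toAffine.Point ((2 : ℕ) : ℤ))]
    (hT : W.twoIsogenyCodomain.twoTorsionPoint ∈ Set.range W.twoIsogenyFun) :
    4 ≤ Nat.card (AddSubgroup.torsionBy W.toAffine.Point ((2 : ℕ) : ℤ)) := by
  obtain ⟨P, hP⟩ := hT
  have hT0 : W.twoIsogenyCodomain.twoTorsionPoint ≠ 0 := Affine.Point.some_ne_zero _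
  -- `P = (x, y)` with `x ≠ 0` and `y = 0`
  rcases P with _ | ⟨x, y, h⟩
  · exact absurd hP.symm hT0
  have hx : x ≠ 0 := by
    intro hx
    rw [twoIsogenyFun_some_of_eq_zero _ h hx] at hP
    exact hT0 hP.symm
  rw [twoIsogenyFun_some _ h hx, twoTorsionPoint, Affine.Point.some.injEq] at hP
  have hquad : x ^ 2 + W.a₂ * x + W.a₄ = 0 := by
    have := hP.1
    rwa [twoIsogenyX, div_eq_zero_iff, or_iff_left hx] at this
  have hy : y = 0 := by
    have e := rel_of_nonsingular W h
    have : y ^ 2 = 0 := by rw [e]; linear_combination x * hquad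
    exact pow_eq_zero_iff two_ne_zero |>.mp this
  subst hy
  -- the four points
  set T : W.toAffine.Point := W.twoTorsionPoint with hTdef
  set P : W.toAffine.Point := .some x 0 h with hPdef
  have hmem : ∀ Q : W.toAffine.Point, Q + Q = 0 →
      Q ∈ AddSubgroup.torsionBy W.toAffine.Point ((2 : ℕ) : ℤ) := fun Q hQ => by
    rw [AddSubgroup.torsionBy.nsmul_iff, two_nsmul, hQ]
  have hTT : T + T = 0 := twoTorsionPoint_add_twoTorsionPoint W
  have hPP : P + P = 0 := Affine.Point.add_self_of_Y_eq (by simp)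
  have hPT : (P + T) + (P + T) = 0 := by
    rw [add_add_add_comm, hPP, hTT, add_zero]
  have hP0 : P ≠ 0 := Affine.Point.some_ne_zero _
  have hT0' : T ≠ 0 := Affine.Point.some_ne_zero _
  have hPT' : P ≠ T := by
    rw [hPdef, hTdef, twoTorsionPoint]
    intro hh
    rw [Affine.Point.some.injEq] at hh
    exact hx hh.1
  have hnegT : -T = T := neg_twoTorsionPoint W
  let f : Fin 4 → AddSubgroup.torsionBy W.toAffine.Point ((2 : ℕ) : ℤ) :=
    ![⟨0, zero_mem _⟩, ⟨T, hmem T hTT⟩, ⟨P, hmem P hPP⟩, ⟨P + T, hmem _ hPT⟩]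
  have hf : Function.Injective f := by
    intro i j hij
    have h01 : (0 : W.toAffine.Point) ≠ T := hT0'.symm
    have h02 : (0 : W.toAffine.Point) ≠ P := hP0.symm
    have h03 : (0 : W.toAffine.Point) ≠ P + T := fun hh =>
      hPT' (by rw [← hnegT]; exact eq_neg_of_add_eq_zero_left hh.symm)
    have h12 : T ≠ P := hPT'.symm
    have h13 : T ≠ P + T := fun hh => hP0 (by simpa using hh.symm)
    have h23 : P ≠ P + T := fun hh => hT0' (by simpa using hh.symm)
    fin_cases i <;> fin_cases j <;>
      simp_all [f, Subtype.ext_iff]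
  have := Nat.card_le_card_of_injective f hf
  rwa [Nat.card_eq_fintype_card, Fintype.card_fin] at this

/-! ### `[A : H] ≤ #α(E(F))` for a subgroup `H ⊇ ker α` -/

/-- If a subgroup `H` of `E(F)` contains `ker α`, then `[E(F) : H] ≤ [E(F) : ker α] = #α(E(F))`
(`α` is a homomorphism, Silverman–Tate Prop. 3.8(a); "`α(Γ) ≅ Γ/ker(α)`", §3.6). Stated for a
finite image `α(E(F))`. [cite: SilvermanTate2015, Prop. 3.8(a)–(b) and §3.6] -/
theorem index_le_natCard_range_xSqClass (H : AddSubgroup W.toAffine.Point)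
    (hH : ∀ P : W.toAffine.Point, W.xSqClass P = 1 → P ∈ H)
    (hfin : (Set.range W.xSqClass).Finite) : H.index ≤ Nat.card (Set.range W.xSqClass) := by
  -- `α` as an additive homomorphism to `Additive (F*/F*²)`
  let α : W.toAffine.Point →+ Additive (SqUnits F) :=
    AddMonoidHom.mk' (fun P => Additive.ofMul (W.xSqClass P)) fun P Q => by
      rw [xSqClass_add]; rfl
  have hα : ∀ P, α P = Additive.ofMul (W.xSqClass P) := fun P => rfl
  have hker : α.ker ≤ H := fun P hP => hH P (by
    rw [AddMonoidHom.mem_ker, hα] at hP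
    exact ofMul_eq_zero.mp hP)
  have hrange : Set.range α = Additive.ofMul '' Set.range W.xSqClass := by
    ext g
    simp only [Set.mem_range, Set.mem_image, hα]
    constructor
    · rintro ⟨P, rfl⟩; exact ⟨W.xSqClass P, ⟨P, rfl⟩, rfl⟩
    · rintro ⟨_, ⟨P, rfl⟩, rfl⟩; exact ⟨P, rfl⟩
  have hcard : α.ker.index = Nat.card (Set.range W.xSqClass) := by
    rw [AddSubgroup.index_ker, ← SetLike.coe_sort_coe, AddMonoidHom.coe_range, hrange,
      Nat.card_image_of_injective Additive.ofMul.injective]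
  have hdvd : H.index ∣ Nat.card (Set.range W.xSqClass) := hcard ▸ AddSubgroup.index_dvd_of_le hker
  haveI : Finite (Set.range W.xSqClass) := hfin.to_subtype
  haveI : Nonempty (Set.range W.xSqClass) := ⟨⟨1, 0, W.xSqClass_zero⟩⟩
  exact Nat.le_of_dvd Nat.card_pos hdvd

end WeierstrassCurve

namespace Literature.NumberTheory.EllipticCurves

open _root_.WeierstrassCurve
open _root_.WeierstrassCurve.Affine (SqUnits sqClass sqClass_mul sqClass_sq sqClass_eq_one_iff)

/-! ### The index identity of §3.6 (a sharpening of Lemma 3.9) -/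

/-- **The index identity behind `2^r = #α(Γ)·#ᾱ(Γ̄)/4`** (Silverman–Tate, Lemma 3.9 and §3.6:
"`(Γ : 2Γ) = (Γ : ψ(Γ̄)) (ψ(Γ̄) : ψ∘φ(Γ))`" and the abstract remark
"`(ψ(A) : ψ(B)) = (A : B)/(ker ψ : ker ψ ∩ B)`" applied with `A = Γ̄`, `B = φ(Γ)`). For abelian
groups `A, B` and homomorphisms `φ : A → B`, `ψ : B → A` with `ψ ∘ φ = 2`:
`[A : 2A] · [ker ψ : ker ψ ∩ φ(A)] = [A : ψ(B)] · [B : φ(A)]` (indices in Mathlib's sense, `0`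
for infinite index; no finiteness is needed for the identity). [cite: SilvermanTate2015, Lemma 3.9 and §3.6] -/
theorem index_nsmulRange_mul_relIndex_eq {A B : Type*} [AddCommGroup A] [AddCommGroup B]
    (φ : A →+ B) (ψ : B →+ A) (h : ∀ a, ψ (φ a) = 2 • a) :
    (nsmulAddMonoidHom 2 : A →+ A).range.index * φ.range.relIndex ψ.ker =
      ψ.range.index * φ.range.index := by
  -- `2A = ψ(φ(A))`
  have h2A : (nsmulAddMonoidHom 2 : A →+ A).range = φ.range.map ψ := by
    ext x
    simp only [AddMonoidHom.mem_range, nsmulAddMonoidHom_apply, AddSubgroup.mem_map]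
    constructor
    · rintro ⟨a, rfl⟩
      exact ⟨φ a, ⟨a, rfl⟩, h a⟩
    · rintro ⟨_, ⟨a, rfl⟩, rfl⟩
      exact ⟨a, (h a).symm⟩
  -- `[A : ψφA] = [ψB : ψφA] · [A : ψB]`
  have h1 : (φ.range.map ψ).relIndex ψ.range * ψ.range.index = (φ.range.map ψ).index :=
    AddSubgroup.relIndex_mul_index (AddSubgroup.map_le_range ψ _)
  -- `[ψB : ψφA] = [B : φA + ker ψ]`
  have h2 : (φ.range.map ψ).relIndex ψ.range = (φ.range ⊔ ψ.ker).index := by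
    rw [← AddSubgroup.comap_map_eq ψ φ.range, ← AddSubgroup.relIndex_top_right,
      AddSubgroup.relIndex_comap, ← AddMonoidHom.range_eq_map]
  -- `[B : φA] = [φA + ker ψ : φA] · [B : φA + ker ψ]`, `[φA + ker ψ : φA] = [ker ψ : φA ∩ ker ψ]`
  have h3 : φ.range.relIndex (φ.range ⊔ ψ.ker) * (φ.range ⊔ ψ.ker).index = φ.range.index :=
    AddSubgroup.relIndex_mul_index le_sup_left
  have h4 : φ.range.relIndex (φ.range ⊔ ψ.ker) = φ.range.relIndex ψ.ker :=
    AddSubgroup.relIndex_sup_left ψ.ker φ.range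
  rw [h2A, ← h1, h2, ← h3, h4]
  ring

/-! ### Over a number field: `2^{r+2} ≤ #α(Γ) · #ᾱ(Γ̄)` -/

/-- **`2^{r + 2} ≤ #α(Γ) · #ᾱ(Γ̄)`** (Silverman–Tate §3.6: "`2^r = #α(Γ)·#ᾱ(Γ̄)/4`", as an
inequality, which is all the rank bound needs). For `E : y² = x³ + ax² + bx` elliptic over a number
field `K` with `Γ = E(K)` finitely generated (Mordell–Weil, tree `module_finite_point_holds`) of
rank `r`: `(Γ : 2Γ) = 2^r · #Γ[2]` (`natCard_quotient_nsmulRange_point_eq`);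
`(Γ : 2Γ) · (ker ψ : ker ψ ∩ φΓ) = (Γ : ψΓ̄) · (Γ̄ : φΓ)` (`index_nsmulRange_mul_relIndex_eq`);
`#Γ[2] · (ker ψ : ker ψ ∩ φΓ) ≥ 4` (if `T̄ ∈ φΓ` then `#Γ[2] ≥ 4`, otherwise
`T̄ ∈ ker ψ ∖ φΓ` and `#Γ[2] ≥ 2`); and `(Γ : ψΓ̄) ≤ #α(Γ)`, `(Γ̄ : φΓ) ≤ #ᾱ(Γ̄)` because
`ker α ⊆ ψ(Γ̄)`, `ker ᾱ ⊆ φ(Γ)` (Prop. 3.8(b)). Stated for finite images `α(Γ)`, `ᾱ(Γ̄)`.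
[cite: SilvermanTate2015, §3.6 (2^r = #α(Γ)·#ᾱ(Γ̄)/4)] -/
theorem two_pow_mordellWeilRank_add_two_le {K : Type*} [Field K] [NumberField K]
    (W : WeierstrassCurve K) [W.IsTwoTorsionNF] [W.IsElliptic]
    (hα : (Set.range W.xSqClass).Finite)
    (hα' : (Set.range W.twoIsogenyCodomain.xSqClass).Finite) :
    2 ^ (W.mordellWeilRank + 2) ≤
      Nat.card (Set.range W.xSqClass) * Nat.card (Set.range W.twoIsogenyCodomain.xSqClass) := by
  obtain ⟨ψ, hψφ, hTker, hker, hαψ⟩ := W.exists_dual_twoIsogenyHom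
  set φ : W.toAffine.Point →+ W.twoIsogenyCodomain.toAffine.Point := W.twoIsogenyHom with hφ
  set T2 := AddSubgroup.torsionBy W.toAffine.Point ((2 : ℕ) : ℤ) with hT2
  haveI : Module.Finite ℤ W.toAffine.Point := W.module_finite_point_holds
  haveI : Finite T2 := finite_torsionBy_of_moduleFinite W.toAffine.Point 2
  -- `ker ψ` is finite (`⊆ {𝒪̄, T̄}`)
  haveI : Finite ψ.ker := by
    have hsub : (ψ.ker : Set W.twoIsogenyCodomain.toAffine.Point) ⊆
        {0, W.twoIsogenyCodomain.twoTorsionPoint} := fun Q hQ => by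
      simpa only [Set.mem_insert_iff, Set.mem_singleton_iff] using hker Q hQ
    exact ((Set.toFinite _).subset hsub).to_subtype
  -- `(Γ : 2Γ) = 2^r #Γ[2]`
  have hcount : (nsmulAddMonoidHom 2 : W.toAffine.Point →+ W.toAffine.Point).range.index =
      2 ^ W.mordellWeilRank * Nat.card T2 :=
    natCard_quotient_nsmulRange_point_eq W 2
  -- the index identity
  have hidx := index_nsmulRange_mul_relIndex_eq φ ψ fun P => hψφ P
  -- `#Γ[2] · (ker ψ : ker ψ ∩ φΓ) ≥ 4`
  have h4 : 4 ≤ Nat.card T2 * φ.range.relIndex ψ.ker := by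
    by_cases hT : W.twoIsogenyCodomain.twoTorsionPoint ∈ Set.range W.twoIsogenyFun
    · have htor : 4 ≤ Nat.card T2 := W.four_le_natCard_torsionBy_of_mem_range hT
      have hrel : 1 ≤ φ.range.relIndex ψ.ker :=
        Nat.one_le_iff_ne_zero.mpr AddSubgroup.index_ne_zero_of_finite
      calc 4 = 4 * 1 := by ring
        _ ≤ Nat.card T2 * φ.range.relIndex ψ.ker := Nat.mul_le_mul htor hrel
    · -- `#Γ[2] ≥ 2`: `𝒪 ≠ T`
      have htor : 2 ≤ Nat.card T2 := by
        have hTmem : W.twoTorsionPoint ∈ T2 := by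
          rw [hT2, AddSubgroup.torsionBy.nsmul_iff, two_nsmul, twoTorsionPoint_add_twoTorsionPoint]
        haveI : Nontrivial T2 :=
          ⟨⟨⟨0, zero_mem _⟩, ⟨_, hTmem⟩, fun hh => Affine.Point.some_ne_zero _
            (Subtype.ext_iff.mp hh).symm⟩⟩
        exact Finite.one_lt_card
      -- `(ker ψ : ker ψ ∩ φΓ) ≥ 2`: `T̄ ∈ ker ψ`, `T̄ ∉ φΓ`
      have hrel : 2 ≤ φ.range.relIndex ψ.ker := by
        rw [AddSubgroup.relIndex]
        refine AddSubgroup.one_lt_index_of_ne_top fun htop => hT ?_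
        have hmem : (⟨_, hTker⟩ : ψ.ker) ∈ φ.range.addSubgroupOf ψ.ker := by
          rw [htop]; exact AddSubgroup.mem_top _
        rw [AddSubgroup.mem_addSubgroupOf] at hmem
        obtain ⟨P, hP⟩ := hmem
        exact ⟨P, hP⟩
      calc 4 = 2 * 2 := by ring
        _ ≤ Nat.card T2 * φ.range.relIndex ψ.ker := Nat.mul_le_mul htor hrel
  -- `2^{r+2} ≤ (Γ : ψΓ̄)(Γ̄ : φΓ)`
  have key : 2 ^ (W.mordellWeilRank + 2) ≤ ψ.range.index * φ.range.index := by
    rw [← hidx, hcount, pow_add, mul_assoc]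
    exact Nat.mul_le_mul_left _ h4
  -- `(Γ : ψΓ̄) ≤ #α(Γ)`, `(Γ̄ : φΓ) ≤ #ᾱ(Γ̄)`
  have hψ : ψ.range.index ≤ Nat.card (Set.range W.xSqClass) :=
    W.index_le_natCard_range_xSqClass ψ.range hαψ hα
  have hφ' : φ.range.index ≤ Nat.card (Set.range W.twoIsogenyCodomain.xSqClass) :=
    W.twoIsogenyCodomain.index_le_natCard_range_xSqClass φ.range (fun Q hQ => by
      obtain ⟨P, hP⟩ := W.mem_range_twoIsogenyFun_of_xSqClass_eq_one Q hQ
      exact ⟨P, hP⟩) hα'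
  exact key.trans (Nat.mul_le_mul hψ hφ')

/-! ### Over `ℚ`: `α(Γ) ⊆ S(a, b)`, `#α(Γ) ≤ #S(a, b)` -/

/-- **Square-free kernel of a rational with even valuations away from `b`.** If `x ∈ ℚ*` has even
`p`-adic valuation at every prime `p ∤ b` (`b ≠ 0`), then `x = d · r²` with `d` a squarefree
divisor of `b` (unique factorisation: `x = ± k² m / e²` with `m` squarefree, and a prime factor
`p` of `m` has `v_p(x)` odd, so `p ∣ b`). [folklore] -/
theorem exists_squarefree_dvd_eq_mul_sq {b : ℤ} (hb : b ≠ 0) {x : ℚ} (hx : x ≠ 0)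
    (heven : ∀ p : ℕ, p.Prime → ¬ (p : ℤ) ∣ b → Even (padicValRat p x)) :
    ∃ d : ℤ, Squarefree d ∧ d ∣ b ∧ ∃ r : ℚ, x = d * r ^ 2 := by
  -- squarefree decomposition of `x.num * x.den`
  set n : ℤ := x.num with hn
  set e : ℕ := x.den with he
  have hn0 : n ≠ 0 := Rat.num_ne_zero.mpr hx
  have he0 : 0 < e := x.den_pos
  have hne : (n * e).natAbs ≠ 0 :=
    Int.natAbs_ne_zero.mpr (mul_ne_zero hn0 (by exact_mod_cast he0.ne'))
  obtain ⟨m, k, hm, hk, hkm, hsq⟩ := Nat.sq_mul_squarefree_of_pos (Nat.pos_of_ne_zero hne)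
  set d : ℤ := n.sign * m with hd
  have hdabs : d.natAbs = m := by
    rw [hd, Int.natAbs_mul, Int.natAbs_sign_of_ne_zero hn0, one_mul, Int.natAbs_natCast]
  have hd0 : d ≠ 0 := Int.natAbs_ne_zero.mp (by rw [hdabs]; exact hm.ne')
  have hsqd : Squarefree d := Int.squarefree_natAbs.mp (by rw [hdabs]; exact hsq)
  -- `x = d (k/e)²`
  have hne' : (n : ℚ) * e = n.sign * ((k : ℚ) ^ 2 * m) := by
    have h1 : n * (e : ℤ) = (n * (e : ℤ)).sign * ((n * (e : ℤ)).natAbs : ℤ) :=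
      (Int.sign_mul_natAbs _).symm
    rw [Int.sign_mul, Int.sign_natCast_of_ne_zero he0.ne', mul_one, ← hkm] at h1
    exact_mod_cast h1
  have hxe : x = n / e := (Rat.num_div_den x).symm
  have he0' : (e : ℚ) ≠ 0 := by exact_mod_cast he0.ne'
  have hxd : x = d * ((k : ℚ) / e) ^ 2 :=
    calc x = n / e := hxe
      _ = n * e / (e * e) := by rw [mul_div_mul_right _ _ he0']
      _ = n.sign * ((k : ℚ) ^ 2 * m) / (e * e) := by rw [hne']
      _ = d * ((k : ℚ) / e) ^ 2 := by rw [hd]; push_cast; ring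
  refine ⟨d, hsqd, ?_, (k : ℚ) / e, hxd⟩
  -- `d ∣ b`: every prime factor `p` of `m = |d|` divides `b`, since `v_p(x) = 1 + 2 v_p(k/e)` is odd
  rw [← Int.natAbs_dvd_natAbs, hdabs, ← Nat.prod_primeFactors_of_squarefree hsq,
    Nat.prod_primeFactors_dvd_iff (Int.natAbs_ne_zero.mpr hb)]
  intro p hp
  have hpp : p.Prime := Nat.prime_of_mem_primeFactors hp
  have hpm : p ∣ m := Nat.dvd_of_mem_primeFactors hp
  haveI : Fact p.Prime := ⟨hpp⟩
  rw [Nat.mem_primeFactors]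
  refine ⟨hpp, ?_, Int.natAbs_ne_zero.mpr hb⟩
  by_contra hpb
  have hpb' : ¬ (p : ℤ) ∣ b := fun h' => hpb (Int.natCast_dvd.mp h')
  have hev := heven p hpp hpb'
  -- `v_p(d) = 1`
  have hvd : padicValRat p (d : ℚ) = 1 := by
    rw [padicValRat.of_int, padicValInt, hdabs, ← Nat.factorization_def m hpp]
    have h1 : m.factorization p ≤ 1 := Squarefree.natFactorization_le_one p hsq
    have h2 : 1 ≤ m.factorization p := (Nat.Prime.dvd_iff_one_le_factorization hpp hm.ne').mp hpm
    have : m.factorization p = 1 := le_antisymm h1 h2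
    rw [this, Nat.cast_one]
  have hr0 : (k : ℚ) / e ≠ 0 := div_ne_zero (by exact_mod_cast hk.ne') he0'
  rw [hxd, padicValRat.mul (by exact_mod_cast hd0) (pow_ne_zero 2 hr0), padicValRat.pow,
    hvd] at hev
  obtain ⟨j, hj⟩ := hev
  omega

variable {a b : ℤ}

/-- **`α(Γ) ⊆ {± p₁^{ε₁} ⋯ p_t^{ε_t} : pᵢ ∣ b}`** (Silverman–Tate, Prop. 3.8(c), and §3.6:
"modulo squares, the x-coordinate of any point on the curve is one of the values of `b₁`",
`b₁ ∣ b`): every class in the image of `α : E_{a,b}(ℚ) → ℚ*/ℚ*²` is the class of a squarefree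
divisor `d` of `b` — `α(𝒪) = [1]`, `α(T) = [b]`, and for `x ≠ 0` the valuation `v_p(x)` is even
at every `p ∤ b` (tree `even_padicValRat_of_twoTorsionNF`). [cite: SilvermanTate2015, Prop. 3.8(c)] -/
theorem exists_squarefree_dvd_sqClass_eq (hab : b * (a ^ 2 - 4 * b) ≠ 0) {c : SqUnits ℚ}
    (hc : c ∈ Set.range (⟨0, (a : ℚ), 0, (b : ℚ), 0⟩ : WeierstrassCurve ℚ).xSqClass) :
    ∃ d : ℤ, Squarefree d ∧ d ∣ b ∧ sqClass (d : ℚ) = c := by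
  have hb : b ≠ 0 := left_ne_zero_of_mul hab
  obtain ⟨P, rfl⟩ := hc
  rcases P with _ | ⟨x, y, h⟩
  · refine ⟨1, squarefree_one, one_dvd b, ?_⟩
    rw [← Affine.Point.zero_def, xSqClass_zero, Int.cast_one]
    exact (sqClass_eq_one_iff one_ne_zero).mpr ⟨1, by ring⟩
  · -- the relevant non-zero rational: `x`, or `b` for `P = T`
    obtain ⟨x', hx'0, hclass, heven⟩ : ∃ x' : ℚ, x' ≠ 0 ∧
        (⟨0, (a : ℚ), 0, (b : ℚ), 0⟩ : WeierstrassCurve ℚ).xSqClass (.some x y h) = sqClass x' ∧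
        ∀ p : ℕ, p.Prime → ¬ (p : ℤ) ∣ b → Even (padicValRat p x') := by
      by_cases hx : x = 0
      · refine ⟨b, by exact_mod_cast hb, xSqClass_some_of_eq_zero h hx, fun p hp hpb => ?_⟩
        haveI : Fact p.Prime := ⟨hp⟩
        rw [KramerTwoDescent.padicValRat_intCast_eq_zero hpb]
        exact ⟨0, rfl⟩
      · refine ⟨x, hx, xSqClass_some_of_ne_zero h hx, fun p hp hpb => ?_⟩
        haveI : Fact p.Prime := ⟨hp⟩
        exact even_padicValRat_of_twoTorsionNF
          (rel_of_nonsingular (⟨0, (a : ℚ), 0, (b : ℚ), 0⟩ : WeierstrassCurve ℚ) h) hx hpb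
    obtain ⟨d, hsq, hdvd, r, hr⟩ := exists_squarefree_dvd_eq_mul_sq hb hx'0 heven
    have hd0 : (d : ℚ) ≠ 0 := by exact_mod_cast hsq.ne_zero
    have hr0 : r ^ 2 ≠ 0 := fun h0 => hx'0 (by rw [hr, h0, mul_zero])
    refine ⟨d, hsq, hdvd, ?_⟩
    rw [hclass, hr, sqClass_mul hd0 hr0, sqClass_sq, Affine.SqUnits.mul_one]

/-- A `ℚ`-point of the homogeneous space `w² = d u⁴ + a u²z² + d' z⁴` is a point over every field
of characteristic `0` (a global point is a local point everywhere). [folklore] -/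
theorem isSoluble_map_twoIsogenyQuartic_of_rat {L : Type*} [Field L] [CharZero L] {a d d' : ℤ}
    (h : ((twoIsogenyQuartic a d d').map (Int.castRingHom ℚ)).IsSoluble) :
    ((twoIsogenyQuartic a d d').map (Int.castRingHom L)).IsSoluble := by
  obtain ⟨u, z, w, h0, h⟩ := h
  refine ⟨u, z, w, ?_, ?_⟩
  · rcases h0 with hu | hz
    · exact Or.inl (by exact_mod_cast hu)
    · exact Or.inr (by exact_mod_cast hz)
  · rw [eval_map_twoIsogenyQuartic] at h ⊢
    simp only [eq_intCast] at h ⊢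
    exact_mod_cast congrArg (fun t : ℚ => (t : L)) h

/-- **`α(Γ) ↪ S(a, b)`**: every class in `α(E_{a,b}(ℚ))` is `[d]` for a (unique) `d` in the
explicit Selmer set `twoIsogenySelmerGroup a b` — `d` is a squarefree divisor of `b`
(`exists_squarefree_dvd_sqClass_eq`), and `[d] ∈ α(E(ℚ))` makes the homogeneous space
`w² = d u⁴ + a u²z² + (b/d) z⁴` soluble over `ℚ` (`isSoluble_map_twoIsogenyQuartic_iff`,
Silverman–Tate §3.6), hence over `ℝ` and every `ℚ_p` ("`α(Γ) ⊆ S^{(φ̂)}`": a global point is a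
local point everywhere; Silverman, *AEC*, Prop. X.4.9). [cite: SilvermanTate2015, §3.6] -/
theorem range_xSqClass_subset_image_twoIsogenySelmerGroup (hab : b * (a ^ 2 - 4 * b) ≠ 0) :
    Set.range (⟨0, (a : ℚ), 0, (b : ℚ), 0⟩ : WeierstrassCurve ℚ).xSqClass ⊆
      ↑((twoIsogenySelmerGroup a b).image fun d : ℤ => sqClass (d : ℚ)) := by
  have hb : b ≠ 0 := left_ne_zero_of_mul hab
  haveI := isElliptic_mk_of_ne_zero (F := ℚ) hab
  intro c hc
  obtain ⟨d, hsq, hdvd, rfl⟩ := exists_squarefree_dvd_sqClass_eq hab hc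
  rw [Finset.coe_image]
  refine ⟨d, ?_, rfl⟩
  rw [Finset.mem_coe, mem_twoIsogenySelmerGroup_iff hb]
  have hsol : ((twoIsogenyQuartic a d (b / d)).map (Int.castRingHom ℚ)).IsSoluble :=
    (isSoluble_map_twoIsogenyQuartic_iff (F := ℚ) (Int.mul_ediv_cancel' hdvd)).mpr hc
  exact ⟨hsq, hdvd, isSoluble_map_twoIsogenyQuartic_of_rat hsol,
    fun p _ => isSoluble_map_twoIsogenyQuartic_of_rat hsol⟩

/-- **`#α(E_{a,b}(ℚ)) ≤ #S(a, b)`** and `α(E_{a,b}(ℚ))` is finite (Silverman–Tate Prop. 3.8(c)–(d):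
`(Γ : ψ(Γ̄)) = #α(Γ) ≤ 2^{t+1}`; here sharpened to the explicit Selmer set, `α(Γ) ⊆ S^{(φ̂)}`).
[cite: SilvermanTate2015, Prop. 3.8(c)–(d) and §3.6] -/
theorem natCard_range_xSqClass_le (hab : b * (a ^ 2 - 4 * b) ≠ 0) :
    (Set.range (⟨0, (a : ℚ), 0, (b : ℚ), 0⟩ : WeierstrassCurve ℚ).xSqClass).Finite ∧
      Nat.card (Set.range (⟨0, (a : ℚ), 0, (b : ℚ), 0⟩ : WeierstrassCurve ℚ).xSqClass) ≤
        (twoIsogenySelmerGroup a b).card := by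
  have hsub := range_xSqClass_subset_image_twoIsogenySelmerGroup hab
  have hfin : (↑((twoIsogenySelmerGroup a b).image fun d : ℤ => sqClass (d : ℚ)) :
      Set (SqUnits ℚ)).Finite := Finset.finite_toSet _
  refine ⟨hfin.subset hsub, (Nat.card_mono hfin hsub).trans ?_⟩
  rw [Nat.card_coe_set_eq, Set.ncard_coe_finset]
  exact Finset.card_image_le

/-! ### The rank bound -/

/-- The `2`-isogenous curve of `E_{a,b}` is the literal `E_{-2a, a²-4b}` (casts). [folklore] -/
theorem twoIsogenyCodomain_mk_intCast (a b : ℤ) :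
    (⟨0, (a : ℚ), 0, (b : ℚ), 0⟩ : WeierstrassCurve ℚ).twoIsogenyCodomain =
      ⟨0, ((-2 * a : ℤ) : ℚ), 0, ((a ^ 2 - 4 * b : ℤ) : ℚ), 0⟩ := by
  ext <;> simp [twoIsogenyCodomain]

/-- **Rank bound from the descent via `2`-isogeny, proved** — discharge of the named fact
`twoIsogeny_mordellWeilRank_add_two_le` (Silverman–Tate, *Rational Points on Elliptic Curves*,
§3.6: "`2^r = #α(Γ)·#ᾱ(Γ̄)/4`", with `α(Γ) ⊆ S^{(φ̂)}(E'/ℚ)`, `ᾱ(Γ̄) ⊆ S^{(φ)}(E/ℚ)`): for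
`a, b ∈ ℤ` with `b(a² - 4b) ≠ 0` and `E : y² = x³ + ax² + bx`,
`rank E(ℚ) + 2 ≤ dim₂ S(a, b) + dim₂ S(-2a, a² - 4b)`. Assembly:
`2^{r+2} ≤ #α(Γ)·#ᾱ(Γ̄)` (`two_pow_mordellWeilRank_add_two_le`, from Mordell–Weil,
`(Γ : 2Γ) = 2^r #Γ[2]`, `ψ ∘ φ = [2]`, `ker α ⊆ ψ(Γ̄)`, `ker ᾱ ⊆ φ(Γ)` and the count of
`2`-torsion), `#α(Γ) ≤ #S(a, b)`, `#ᾱ(Γ̄) ≤ #S(-2a, a² - 4b)` (`natCard_range_xSqClass_le`), and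
`#S = 2^{dim₂ S}` (`two_pow_twoIsogenySelmerRank_eq_card`).
[cite: SilvermanTate2015, §3.6 (the formula 2^r = #α(Γ)·#ᾱ(Γ̄)/4)] -/
theorem twoIsogeny_mordellWeilRank_add_two_le_holds : twoIsogeny_mordellWeilRank_add_two_le := by
  intro a b hab
  haveI := isElliptic_mk_of_ne_zero (F := ℚ) hab
  have hab' := twoIsogenyCodomain_ne_zero hab
  obtain ⟨hfin₁, hc₁⟩ := natCard_range_xSqClass_le hab
  obtain ⟨hfin₂, hc₂⟩ := natCard_range_xSqClass_le hab'
  rw [← twoIsogenyCodomain_mk_intCast a b] at hfin₂ hc₂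
  have key := two_pow_mordellWeilRank_add_two_le
    (⟨0, (a : ℚ), 0, (b : ℚ), 0⟩ : WeierstrassCurve ℚ) hfin₁ hfin₂
  have h2 : 2 ^ ((⟨0, (a : ℚ), 0, (b : ℚ), 0⟩ : WeierstrassCurve ℚ).mordellWeilRank + 2) ≤
      2 ^ (twoIsogenySelmerRank a b + twoIsogenySelmerRank' a b) := by
    rw [pow_add 2 (twoIsogenySelmerRank a b), two_pow_twoIsogenySelmerRank_eq_card hab,
      two_pow_twoIsogenySelmerRank'_eq_card hab]
    exact key.trans (Nat.mul_le_mul hc₁ hc₂)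
  exact (Nat.pow_le_pow_iff_right (by norm_num)).mp h2

end Literature.NumberTheory.EllipticCurves
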